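import Literature.Barriers.AtomisticToContinuum.AnticontinuumLocalizationSolution
import HarnessLib

/-!
# De Roeck–Huveneers 2015, §5.4–5.6 for the rotor chain, I: the resonant sets `Z`, `Z₁` and term-level vanishing

`Literature/Barriers/AtomisticToContinuum/` — continuation of `AnticontinuumLocalizationSolution.lean`.
Term-level facts behind the crucial cancellation of §5.4 and the first claim of Lemma 4 (§5.5) of W. De Roeck,
F. Huveneers, CPAM 68 (2015), arXiv:1305.5127, all PROVED:

* a resonant term (an image of `𝓡`) vanishes identically near every point where its mode is
  non-resonant, so its gradient and all its brackets vanish there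
  (`resonantOnly_ev_eventuallyEq_zero`, `fderiv_ev_eq_zero_of_nonres`);
* `{t, g(ω)} = (a sin(k·q) - b cos(k·q)) ∂_k g(ω)` for a function of the momenta (`poisson_ev_comp_snd`),
  and zero-mode terms have zero bracket (`poisson_ev_ev_of_mode_zero`);
* the modes of `H̃` are in `K_r` for `r ≥ max(mode bound, radius)` (`isKMode_of_mem_normalForm`);
  nonzero modes with disjoint supports are linearly independent (`linearIndependent_of_disjoint`);
* **the resonant set `Z`** of §5.5 (`Zset`: `n₂` linearly independent `k_j ∈ K_r` near `a` with
  `|k_j·ω| ≤ η`) and the single-resonance set `Z₁` (`Z1set`), both CLOSED (finite unions of closed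
  slabs) hence measurable — `Z₁` is the set `W` of §5.6 in frequency form;
* **off `Z` the cut-offs are good** (`good_of_not_mem_Zset`): some `θ_y(ω) = 1` (so `ϑ_* = 0`) —
  this is where the ROOM hypothesis (`n₂` sites of `B(a,n₃)` pairwise `> 2R_S` apart, i.e. a window
  large enough) enters, exactly as "By taking `n₃` large enough" in the proof of Lemma 4 — and
  `ω ∉ S(y)` for all `y ∈ B(a,n₃)`; off `Z₁` all `θ_y(ω) = 1` (`theta_eq_one_of_not_mem_Z1set`).
-/

noncomputable section

open Function Set Finset Filter Metric
open scoped ContDiff BigOperators Topology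

namespace Literature.Barriers.AtomisticToContinuum.HeatConduction.RotorChain

open Literature.MathematicalPhysics.KineticTheory.HeatConduction
open Literature.Analysis.Calculus Literature.Analysis.Calculus.IsDeltaSymbol
open Literature.Algebra.Lie Literature.Algebra.Lie.TruncSeries

variable {m : ℕ}

/-! ### Resonant terms vanish near non-resonant momenta -/

/-- A resonant term vanishes identically near `(q, ω)` when `|k·ω| > 2δ` (`ρ_δ(k·ω) = 0` there). [cite: DeRoeckHuveneers2015, §5.4 ("all the factors `ρ_δ(k·ω)` … vanish")] -/
theorem resonantOnly_ev_eventuallyEq_zero {t : TrigTerm m} {δ : ℝ} (h : t.ResonantOnly δ) {z : PhaseSpace m}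
    (hz : 2 * δ < |modeFreq t.mode z.2|) : t.ev δ =ᶠ[𝓝 z] fun _ => 0 := by
  have hopen : IsOpen {z' : PhaseSpace m | 2 * δ < |modeFreq t.mode z'.2|} := by
    have hc : Continuous fun z' : PhaseSpace m => |modeFreq t.mode z'.2| := by
      unfold modeFreq modePhase
      exact (continuous_finsetSum _ fun x _ => continuous_const.mul ((continuous_apply x).comp continuous_snd)).abs
    exact isOpen_lt continuous_const hc
  filter_upwards [hopen.mem_nhds hz] with z' hz'
  have := h z'.2 (le_of_lt hz')
  simp [TrigTerm.ev, this.1, this.2]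

/-- Hence its gradient vanishes there. [folklore] -/
theorem fderiv_ev_eq_zero_of_nonres {t : TrigTerm m} {δ : ℝ} (h : t.ResonantOnly δ) {z : PhaseSpace m}
    (hz : 2 * δ < |modeFreq t.mode z.2|) : fderiv ℝ (t.ev δ) z = 0 := by
  rw [(resonantOnly_ev_eventuallyEq_zero h hz).fderiv_eq]; simp

/-- And the term itself vanishes there. [cite: DeRoeckHuveneers2015, §5.4 ("all the factors `ρ_δ(k·ω)` … vanish")] -/
theorem ev_eq_zero_of_nonres {t : TrigTerm m} {δ : ℝ} (h : t.ResonantOnly δ) {z : PhaseSpace m}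
    (hz : 2 * δ < |modeFreq t.mode z.2|) : t.ev δ z = 0 :=
  (resonantOnly_ev_eventuallyEq_zero h hz).eq_of_nhds

/-! ### Brackets with functions of the momenta; zero modes -/

/-- `∂_{q_y}` of a function of the momenta vanishes. [folklore] -/
theorem partialQ_comp_snd (g : (Fin m → ℝ) → ℝ) (y : Fin m) (z : PhaseSpace m) :
    partialQ y (fun z : PhaseSpace m => g z.2) z = 0 := by
  simp [partialQ]

/-- `∂_{ω_y}` of a function of the momenta is its partial derivative. [folklore] -/
theorem partialP_comp_snd {g : (Fin m → ℝ) → ℝ} (hg : Differentiable ℝ g) (y : Fin m) (z : PhaseSpace m) :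
    partialP y (fun z : PhaseSpace m => g z.2) z = fderiv ℝ g z.2 (Pi.single y 1) := by
  unfold partialP
  have hu : HasDerivAt (fun s : ℝ => update z.2 y s) (Pi.single y (1 : ℝ)) (z.2 y) := by
    have : (fun s : ℝ => update z.2 y s) = fun s => z.2 + (s - z.2 y) • (Pi.single y (1 : ℝ) : Fin m → ℝ) := by
      funext s; ext x
      by_cases hx : x = y
      · subst hx; simp
      · simp [hx]
    rw [this]
    simpa using (((hasDerivAt_id (z.2 y)).sub_const (z.2 y)).smul_const (Pi.single y (1 : ℝ) : Fin m → ℝ)).const_add z.2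
  have h := (hg (update z.2 y (z.2 y))).hasFDerivAt.comp_hasDerivAt (z.2 y) hu
  rw [update_eq_self] at h
  exact h.deriv

/-- **`{t, g(ω)} = (a sin(k·q) - b cos(k·q)) · ∂_k g(ω)`** for a term `t = a cos(k·q) + b sin(k·q)` and a
differentiable function `g` of the momenta. [cite: DeRoeckHuveneers2015, §4.3 proof of Prop. 2 ("`L_{H̃_{n₁}} θ_x(q,ω) = -∇_q H̃·∇_ω θ_x(q,ω) = -i ∑_k (k·∇_ω θ_x(ω)) ρ_δ(k·ω) G(k,ω) e^{ik·q}`")] -/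
theorem poisson_ev_comp_snd (t : TrigTerm m) (δ : ℝ) {g : (Fin m → ℝ) → ℝ} (hg : Differentiable ℝ g)
    (z : PhaseSpace m) :
    poisson (t.ev δ) (fun z : PhaseSpace m => g z.2) z =
      (t.cosCoeff δ z.2 * Real.sin (modePhase t.mode z.1) - t.sinCoeff δ z.2 * Real.cos (modePhase t.mode z.1)) *
        fderiv ℝ g z.2 (modeVec t.mode) := by
  unfold poisson
  simp only [partialQ_comp_snd, mul_zero, zero_sub, partialP_comp_snd hg, TrigTerm.partialQ_ev]
  rw [← sum_mul_clm_single (fderiv ℝ g z.2) (modeVec t.mode), Finset.mul_sum]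
  refine Finset.sum_congr rfl fun y _ => ?_
  simp only [modeVec]
  ring

/-- Zero-mode terms are functions of the momenta: `∂_q` vanishes. [folklore] -/
theorem partialQ_ev_of_mode_zero {t : TrigTerm m} (ht : t.mode = 0) (δ : ℝ) (y : Fin m) (z : PhaseSpace m) :
    partialQ y (t.ev δ) z = 0 := by
  rw [TrigTerm.partialQ_ev, ht]; simp

/-- **Two zero-mode terms have zero bracket** (both are functions of `ω`). [cite: DeRoeckHuveneers2015, §5.4 ("since `D̃_z, D̃_y` depend only on the `ω`-variables, their Poisson bracket vanishes")] -/
theorem poisson_ev_ev_of_mode_zero {t t' : TrigTerm m} (ht : t.mode = 0) (ht' : t'.mode = 0) (δ : ℝ) (z : PhaseSpace m) :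
    poisson (t.ev δ) (t'.ev δ) z = 0 := by
  unfold poisson
  simp [partialQ_ev_of_mode_zero ht, partialQ_ev_of_mode_zero ht']

/-! ### The modes of `H̃` are in `K_r` -/

/-- A radius dominating both the mode bound and the support radius of the scheme. [cite: DeRoeckHuveneers2015, §4 ("`r = r(n₁) = max_{1≤k≤n₁} r_k`")] -/
def IsSchemeRadius (n r : ℕ) : Prop := stageModeBound n n ≤ r ∧ stageRad n n ≤ r

/-- **Nonzero modes of `H̃^{(j)}` lie in `K_r`**, centred at the anchor. [cite: DeRoeckHuveneers2015, §4.1 (definition of `K_r`) and §5.4 ("`H̃_x(q,ω) = ∑_{k ∈ K_r : supp k ⊂ B(x,r)} ρ_δ(k·ω) Ṽ_x(k,ω) e^{ik·q}`")] -/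
theorem isKMode_of_mem_normalForm {n r : ℕ} (hr : IsSchemeRadius n r) (γ : ℝ) {j : ℕ} (hj : j ≤ n) {t : TrigTerm m}
    (ht : t ∈ normalForm m γ n j) (hk : t.mode ≠ 0) : IsKMode r t.mode :=
  ⟨hk, fun y => (stage_modeBound m γ n n j hj t ht y).trans (by exact_mod_cast hr.1),
    ⟨t.pos, fun y hy => ((stage_good m γ n 0 n j hj).1 t ht).1 y (lt_of_le_of_lt hr.2 hy)⟩⟩

/-- The support of a mode of `H̃^{(j)}`: within `r` of its anchor. [cite: DeRoeckHuveneers2015, §5.4 ("`supp k ⊂ B(x,r)`")] -/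
theorem mode_eq_zero_of_far {n r : ℕ} (hr : IsSchemeRadius n r) (γ : ℝ) {j : ℕ} (hj : j ≤ n) {t : TrigTerm m}
    (ht : t ∈ normalForm m γ n j) {y : Fin m} (hy : r < Nat.dist t.pos.val y.val) : t.mode y = 0 :=
  ((stage_good m γ n 0 n j hj).1 t ht).1 y (lt_of_le_of_lt hr.2 hy)

/-- A mode supported within `r` of `c`, with `dist(x, c) ≤ d`, is supported within `d + r` of `x`. [folklore] -/
theorem modeNear_of_anchor {r : ℕ} {k : Fin m → ℤ} {c x : Fin m} (hk : ∀ y, r < Nat.dist c.val y.val → k y = 0) {d : ℕ}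
    (hd : Nat.dist x.val c.val ≤ d) {R : ℕ} (hR : d + r ≤ R) : ModeNear x R k := by
  intro y hy
  apply hk
  have := Nat.dist.triangle_inequality x.val c.val y.val
  omega

/-! ### Linear independence of disjointly supported modes -/

/-- **Nonzero integer modes with pairwise disjoint supports are linearly independent** (as real vectors).
[cite: DeRoeckHuveneers2015, §5.5 proof of Lemma 4 ("By taking `n₃` large enough, we can find `n₂` linearly independent vectors")] -/
theorem linearIndependent_of_disjoint {p : ℕ} {ks : Fin p → (Fin m → ℤ)} (h0 : ∀ j, ks j ≠ 0)
    (hdisj : ∀ i j, i ≠ j → ∀ y, ks i y = 0 ∨ ks j y = 0) :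
    LinearIndependent ℝ (fun j => modeVec (ks j)) := by
  rw [linearIndependent_iff']
  intro s g hsum i hi
  obtain ⟨y, hy⟩ : ∃ y, ks i y ≠ 0 := Function.ne_iff.1 (h0 i)
  have h := congr_fun hsum y
  simp only [Finset.sum_apply, Pi.smul_apply, smul_eq_mul, modeVec, Pi.zero_apply] at h
  rw [Finset.sum_eq_single i (fun j hj hji => ?_) (fun hi' => absurd hi hi')] at h
  · have : (ks i y : ℝ) ≠ 0 := by exact_mod_cast hy
    exact (mul_eq_zero.1 h).resolve_right this
  · rcases hdisj j i hji y with h' | h'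
    · rw [h']; simp
    · exact absurd h' hy

/-! ### The resonant sets `Z` and `Z₁` -/

/-- **The resonant set `Z`** of §5.5: `n₂` linearly independent modes of `K_r`, supported within `Rz`
of the bond, all `η`-resonant ("`n₂` linearly independent vectors `k_1, …, k_{n₂} ∈ K_r` such that
`(∪_j supp(k_j)) ⊂ B(a,2n₃)` and such that `|k_j·ω| ≤ L^{n₂+1}δ`"; here with a free radius `Rz`).
[cite: DeRoeckHuveneers2015, §5.5 (definition of `Z`)] -/
def Zset (m r n₂ : ℕ) (b : Fin m) (Rz : ℕ) (η : ℝ) : Set (Fin m → ℝ) :=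
  {w | ∃ ks : Fin n₂ → (Fin m → ℤ), LinearIndependent ℝ (fun j => modeVec (ks j)) ∧
    ∀ j, IsKMode r (ks j) ∧ ModeNear b Rz (ks j) ∧ |modeFreq (ks j) w| ≤ η}

/-- **The single-resonance set `Z₁`**: some mode of `K_r` supported within `R₁` of the bond is `η`-resonant
(the set `W = {θ_x(ω) < 1 for some x ∈ B(a,n₃)}` lies in it: "for any `(ω,q) ∈ W`, there is at least
one `k ∈ K_r`, with `supp(k) ⊂ B(a,n₃)`, such that `|ω·k| ≤ L^{n₂+1}δ`"). [cite: DeRoeckHuveneers2015, §5.6 (definition of `W`)] -/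
def Z1set (m r : ℕ) (b : Fin m) (R₁ : ℕ) (η : ℝ) : Set (Fin m → ℝ) :=
  {w | ∃ k : Fin m → ℤ, IsKMode r k ∧ ModeNear b R₁ k ∧ |modeFreq k w| ≤ η}

/-- The bounded modes form a finite set. [folklore] -/
theorem finite_boundedModes (m r : ℕ) : Set.Finite {k : Fin m → ℤ | ∀ y, |k y| ≤ r} := by
  have h : {k : Fin m → ℤ | ∀ y, |k y| ≤ r} ⊆ Set.pi Set.univ (fun _ : Fin m => Set.Icc (-(r : ℤ)) r) := by
    intro k hk
    simp only [Set.mem_pi, Set.mem_univ, true_implies, Set.mem_Icc]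
    exact fun y => abs_le.1 (hk y)
  exact (Set.Finite.pi fun _ => Set.finite_Icc _ _).subset h

/-- Tuples of bounded modes form a finite set. [folklore] -/
theorem finite_boundedTuples (m r p : ℕ) : Set.Finite {ks : Fin p → (Fin m → ℤ) | ∀ j y, |ks j y| ≤ r} := by
  have h : {ks : Fin p → (Fin m → ℤ) | ∀ j y, |ks j y| ≤ r} ⊆ Set.pi Set.univ (fun _ : Fin p => {k : Fin m → ℤ | ∀ y, |k y| ≤ r}) := by
    intro ks hks
    simp only [Set.mem_pi, Set.mem_univ, true_implies, Set.mem_setOf_eq]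
    exact hks
  exact (Set.Finite.pi fun _ => finite_boundedModes m r).subset h

/-- A slab `{|k·ω| ≤ η}` is closed. [folklore] -/
theorem isClosed_slab (k : Fin m → ℤ) (η : ℝ) : IsClosed {w : Fin m → ℝ | |modeFreq k w| ≤ η} := by
  have hc : Continuous fun w : Fin m → ℝ => |modeFreq k w| := by
    have : Continuous fun w : Fin m → ℝ => modeFreq k w :=
      continuous_finsetSum _ fun x _ => continuous_const.mul (continuous_apply x)
    exact this.abs
  exact isClosed_le hc continuous_const

/-- **`Z` is closed** (a finite union of closed slab systems). [cite: DeRoeckHuveneers2015, §5.5 ("The set `Z` is closed")] -/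
theorem isClosed_Zset (m r n₂ : ℕ) (b : Fin m) (Rz : ℕ) (η : ℝ) : IsClosed (Zset m r n₂ b Rz η) := by
  have he : Zset m r n₂ b Rz η = ⋃ ks ∈ {ks : Fin n₂ → (Fin m → ℤ) | (∀ j y, |ks j y| ≤ r) ∧
      LinearIndependent ℝ (fun j => modeVec (ks j)) ∧ ∀ j, IsKMode r (ks j) ∧ ModeNear b Rz (ks j)},
      {w | ∀ j, |modeFreq (ks j) w| ≤ η} := by
    ext w
    simp only [Zset, Set.mem_setOf_eq, Set.mem_iUnion, exists_prop]
    constructor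
    · rintro ⟨ks, hli, hks⟩
      exact ⟨ks, ⟨fun j => (hks j).1.2.1, hli, fun j => ⟨(hks j).1, (hks j).2.1⟩⟩, fun j => (hks j).2.2⟩
    · rintro ⟨ks, ⟨-, hli, hks⟩, hw⟩
      exact ⟨ks, hli, fun j => ⟨(hks j).1, (hks j).2, hw j⟩⟩
  rw [he]
  refine Set.Finite.isClosed_biUnion ((finite_boundedTuples m r n₂).subset fun ks hks => hks.1) fun ks _ => ?_
  have : {w : Fin m → ℝ | ∀ j, |modeFreq (ks j) w| ≤ η} = ⋂ j, {w | |modeFreq (ks j) w| ≤ η} := by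
    ext w; simp
  rw [this]
  exact isClosed_iInter fun j => isClosed_slab _ _

/-- **`Z₁` is closed.** [folklore] -/
theorem isClosed_Z1set (m r : ℕ) (b : Fin m) (R₁ : ℕ) (η : ℝ) : IsClosed (Z1set m r b R₁ η) := by
  have he : Z1set m r b R₁ η = ⋃ k ∈ {k : Fin m → ℤ | (∀ y, |k y| ≤ r) ∧ IsKMode r k ∧ ModeNear b R₁ k},
      {w | |modeFreq k w| ≤ η} := by
    ext w
    simp only [Z1set, Set.mem_setOf_eq, Set.mem_iUnion, exists_prop]
    constructor
    · rintro ⟨k, hk, hn, hw⟩; exact ⟨k, ⟨hk.2.1, hk, hn⟩, hw⟩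
    · rintro ⟨k, ⟨-, hk, hn⟩, hw⟩; exact ⟨k, hk, hn, hw⟩
  rw [he]
  exact Set.Finite.isClosed_biUnion ((finite_boundedModes m r).subset fun k hk => hk.1) fun k _ => isClosed_slab _ _

/-- `Z` is measurable. [folklore] -/
theorem measurableSet_Zset (m r n₂ : ℕ) (b : Fin m) (Rz : ℕ) (η : ℝ) : MeasurableSet (Zset m r n₂ b Rz η) :=
  (isClosed_Zset m r n₂ b Rz η).measurableSet

/-- `Z₁` is measurable. [folklore] -/
theorem measurableSet_Z1set (m r : ℕ) (b : Fin m) (R₁ : ℕ) (η : ℝ) : MeasurableSet (Z1set m r b R₁ η) :=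
  (isClosed_Z1set m r b R₁ η).measurableSet

/-- Monotonicity of `Z` in the radius and the width. [folklore] -/
theorem Zset_mono {r n₂ : ℕ} {b : Fin m} {Rz Rz' : ℕ} (hR : Rz ≤ Rz') {η η' : ℝ} (hη : η ≤ η') :
    Zset m r n₂ b Rz η ⊆ Zset m r n₂ b Rz' η' := by
  rintro w ⟨ks, hli, hks⟩
  exact ⟨ks, hli, fun j => ⟨(hks j).1, fun y hy => (hks j).2.1 y (lt_of_le_of_lt hR hy), (hks j).2.2.trans hη⟩⟩

/-! ### Off `Z` the cut-offs are good -/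

section OffZ

variable {r L n₂ : ℕ} (Θ : ResonanceCutoffs m r L n₂) (b : Fin m) (n₃ : ℕ)

/-- **Room**: `n₂` sites of `B(a, n₃)` pairwise more than `2R` apart (available as soon as the window
has `≥ n₂(2R+1)` sites within `n₃` of `a`). [cite: DeRoeckHuveneers2015, §5.5 proof of Lemma 4 ("By taking `n₃` large enough")] -/
def HasRoom (R n₂ : ℕ) (b : Fin m) (n₃ : ℕ) : Prop :=
  ∃ ys : Fin n₂ → Fin m, (∀ j, ys j ∈ nearSites b n₃) ∧ ∀ i j, i ≠ j → 2 * R < Nat.dist (ys i).val (ys j).val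

variable {Θ b n₃}

/-- **If all `θ_y < 1` on `B(a,n₃)` then `ω ∈ Z`** (with radius `n₃ + R_S`): each `y` carries a
near-resonant mode in `K_r(B(y,R_S))`, and `n₂` of them at mutual distance `> 2R_S` have disjoint
supports, hence are linearly independent. [cite: DeRoeckHuveneers2015, §5.5 proof of Lemma 4, first claim ("If `∏(1 - θ_x) ≠ 0` …")] -/
theorem mem_Zset_of_forall_lt_one {δ : ℝ} (hδ : 0 < δ) (hδ1 : δ ≤ 1) (hroom : HasRoom Θ.RS n₂ b n₃) {w : Fin m → ℝ}
    (h : ∀ y ∈ nearSites b n₃, Θ.θ y δ w < 1) {Rz : ℕ} (hRz : n₃ + Θ.RS ≤ Rz) :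
    w ∈ Zset m r n₂ b Rz ((L : ℝ) ^ (n₂ + 1) * δ) := by
  obtain ⟨ys, hys, hsep⟩ := hroom
  choose ks hks using fun j => Θ.nearRes_of_lt_one δ hδ hδ1 (ys j) w (h (ys j) (hys j))
  refine ⟨ks, linearIndependent_of_disjoint (fun j => (hks j).1.1) fun i j hij y => ?_, fun j => ⟨(hks j).1, ?_, (hks j).2.2⟩⟩
  · -- disjoint supports: `y` cannot be within `R_S` of both `ys i` and `ys j`
    by_cases hi : Θ.RS < Nat.dist (ys i).val y.val
    · exact Or.inl ((hks i).2.1 y hi)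
    · right
      apply (hks j).2.1 y
      have := Nat.dist.triangle_inequality (ys i).val y.val (ys j).val
      rw [Nat.dist_comm y.val] at this
      have := hsep i j hij
      omega
  · exact modeNear_of_anchor (hks j).2.1 (mem_nearSites.1 (hys j)) hRz

/-- **If `ω ∈ S(y)` for some `y ∈ B(a,n₃)` then `ω ∈ Z`** (with radius `n₃ + RS`). [cite: DeRoeckHuveneers2015, §5.5 proof of Lemma 4, first claim ("It then follows from the second assertion of Proposition 2 that `ω ∈ S(x)` … This implies `ω ∈ Z`")] -/
theorem mem_Zset_of_mem_multiRes {δ : ℝ} (hδ : 0 < δ) (hδ1 : δ ≤ 1) {w : Fin m → ℝ} {y : Fin m}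
    (hy : y ∈ nearSites b n₃) (h : w ∈ Θ.multiRes y δ) {Rz : ℕ} (hRz : n₃ + Θ.RS ≤ Rz) :
    w ∈ Zset m r n₂ b Rz ((L : ℝ) ^ (n₂ + 1) * δ) := by
  obtain ⟨ks, hli, hks⟩ := Θ.multiRes_subset δ hδ hδ1 y w h
  exact ⟨ks, hli, fun j => ⟨(hks j).1, modeNear_of_anchor (hks j).2.1 (mem_nearSites.1 hy) hRz, (hks j).2.2⟩⟩

/-- **Off `Z` the cut-offs are good**: some `θ_y(ω) = 1` on `B(a,n₃)` (hence `ϑ_*(ω) = 0`), and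
`ω ∉ S(y)` for every `y ∈ B(a,n₃)`. [cite: DeRoeckHuveneers2015, §5.5 proof of Lemma 4, first claim] -/
theorem good_of_not_mem_Zset {δ : ℝ} (hδ : 0 < δ) (hδ1 : δ ≤ 1) (hroom : HasRoom Θ.RS n₂ b n₃) {Rz : ℕ}
    (hRz : n₃ + Θ.RS ≤ Rz) {w : Fin m → ℝ}
    (hw : w ∉ Zset m r n₂ b Rz ((L : ℝ) ^ (n₂ + 1) * δ)) :
    (∃ y ∈ nearSites b n₃, Θ.θ y δ w = 1) ∧ ∀ y ∈ nearSites b n₃, w ∉ Θ.multiRes y δ := by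
  constructor
  · by_contra h
    exact hw (mem_Zset_of_forall_lt_one hδ hδ1 hroom
      (fun y hy => lt_of_le_of_ne (Θ.le_one y δ w) fun h1 => h ⟨y, hy, h1⟩) hRz)
  · intro y hy hmem
    exact hw (mem_Zset_of_mem_multiRes hδ hδ1 hy hmem hRz)

/-- Off `Z`: `ϑ_*(ω) = 0`. [cite: DeRoeckHuveneers2015, §5.5 proof of Lemma 4, first claim] -/
theorem vtStar_eq_zero_of_not_mem_Zset {δ : ℝ} (hδ : 0 < δ) (hδ1 : δ ≤ 1) (hroom : HasRoom Θ.RS n₂ b n₃) {Rz : ℕ}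
    (hRz : n₃ + Θ.RS ≤ Rz) {w : Fin m → ℝ}
    (hw : w ∉ Zset m r n₂ b Rz ((L : ℝ) ^ (n₂ + 1) * δ)) : vtStar Θ b n₃ δ w = 0 := by
  obtain ⟨⟨y, hy, h1⟩, -⟩ := good_of_not_mem_Zset hδ hδ1 hroom hRz hw
  unfold vtStar piCompl
  rw [Finset.prod_eq_zero hy (by rw [h1, sub_self]), zero_div]

/-- **Off `Z₁` all `θ_y(ω) = 1` on `B(a,n₃)`** (radius `n₃ + R_S`), i.e. `Z₁ᶜ ⊆ Wᶜ`. [cite: DeRoeckHuveneers2015, §5.6 (definition of `W`: "`θ_x(ω) < 1` for some `x ∈ B(a,n₃)`")] -/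
theorem theta_eq_one_of_not_mem_Z1set {δ : ℝ} (hδ : 0 < δ) (hδ1 : δ ≤ 1) {R₁ : ℕ} (hR : n₃ + Θ.RS ≤ R₁)
    {w : Fin m → ℝ} (hw : w ∉ Z1set m r b R₁ ((L : ℝ) ^ (n₂ + 1) * δ)) {y : Fin m} (hy : y ∈ nearSites b n₃) :
    Θ.θ y δ w = 1 := by
  by_contra h
  obtain ⟨k, hk, hn, hkw⟩ := Θ.nearRes_of_lt_one δ hδ hδ1 y w (lt_of_le_of_ne (Θ.le_one y δ w) h)
  exact hw ⟨k, hk, modeNear_of_anchor hn (mem_nearSites.1 hy) hR, hkw⟩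

end OffZ

end Literature.Barriers.AtomisticToContinuum.HeatConduction.RotorChain

end
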